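import Mathlib
import Summits.CriticalPhenomena.CardyFormulaZ2.Theorems.CardyFlipRussoSquareFromVoronoiHubDefs
import Summits.CriticalPhenomena.CardyFormulaZ2.Theorems.CardyFlipRussoSquareFromVoronoiHubFaithfulDefs
import Summits.CriticalPhenomena.CardyFormulaZ2.Theorems.CardyFlipRussoSquareFromVoronoiHubSandwichPart1
import Summits.CriticalPhenomena.CardyFormulaZ2.Theorems.CardyFlipRussoSquareFromVoronoiHubFaithfulPart4
import Summits.CriticalPhenomena.CardyFormulaZ2.Theorems.CardyFlipRussoSquareFromVoronoiHubFaithfulPart7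
import Literature.Probability.Percolation.VoronoiCrossing
import Literature.Analysis.FunctionSpaces.PoissonPointProcess

/-!
# Stub `stub_sandwich_of` (K1, S3 + S4), line `Sketch` of crux `SquareFromVoronoiHub`:
# the dual sandwich at cell scale `δ^{1/8}` from S1, S2 and the fat tube

Crux `Summit.CriticalPhenomena.CardyFormulaZ2.Theses.CardyFlipRusso.SquareFromVoronoiHub`
(stmt-CriticalPhenomena-6434), line `Sketch` (card `voronoi-blocks-on-fixed-gs`), K1 ("faithful
discretisation" at cell scale `ε = δ^{1/8}`), registered stub `stub_sandwich_of`: the statements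
of `stub_perturbedRectangles` (S1: perturbed conformal rectangles `R₁`, `R₂` with Cardy values
`θ`-close to `R`'s and a margin `r ∈ lowerMargins R R₁ F₀ F₂ ∩ upperMargins R R₂`), of
`stub_noDefect` (S2: the bulk no-defect event of the dilated nuclei has probability `→ 1` in every
bounded window) and of `stub_fatTube` (a black path in the window has a strictly black fat tube)
IMPLY the SANDWICH consumed by `faithful_of_dual_sandwich_eighth` (Part 3b):
eventually as `δ → 0⁺`,
`vor_{R₁}(ε) - θ ≤ block_R(δ, ε) ≤ 1 - vor^{white}_{R₂}(ε) + θ`, `ε = δ^{1/8}`.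

* `eventually_rpow_le_nhdsGT`, `eventually_thresholds`: along `δ → 0⁺` the thresholds
  `ρ = cellRad δ = δ^{3/32}`, `r₂ = sepRad δ = δ^{3/8}`, `ℓ₀ = edgeLen δ = δ^{5/8}` and the tube
  margin `μ = 4δ` satisfy `4μ ≤ r₂`, `64 μ ρ ≤ ℓ₀ r₂`, `8ρ ≤ 1`, `4ρ ≤ r`, `2δ ≤ r`, `δ < r`;
* `stub_sandwich_of`: window `V = cthickening 1 (closure Ω ∪ closure R₁ ∪ closure R₂)` (bounded,
  `Ω ⊆ interior V`); LOWER: `{vor R₁} ⊆ Block ∪ {defect}` by Part 4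
  `exists_path_of_voronoiCrossing_conformalRectangle`, the fat tube and Sandwich Part 1
  `blockConfig_mem_crudeCrossing_of_tube`, then outer-measure monotonicity/subadditivity;
  UPPER: `{vor^{white} R₂} ∩ Block ⊆ {defect}` by `mem_noDefect_swap`, the white fat tube and
  Sandwich Part 1 `false_of_block_of_whiteTube`, then
  `μ(E) = μ(E ∩ Block) + μ(E \ Block)` (`measureReal_inter_add_sdiff`, valid for the arbitrary set
  `E` because `Block` is measurable: `measurableSet_blockCrossing`), `μ(Blockᶜ) = 1 - μ(Block)`,
  and `voronoiCrossingProb PW PB R₂ ε = (PB ⊗ PW){c | voronoiCrossing … ε c.2 c.1}`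
  (`Measure.prod_swap` through the measurable equivalence `MeasurableEquiv.prodComm`).

(Bollobás–Riordan, *Percolation* (2006), Ch. 7 (19)/Lemma 14 and Ch. 8 §8.3.)
-/

noncomputable section

namespace Summit.CriticalPhenomena.CardyFormulaZ2.Cruxes.SquareFromVoronoiHub.VoronoiBlocks.Faithful

open scoped Topology Pointwise
open Set Filter MeasureTheory Metric
open UpperHalfPlane (upperHalfPlaneSet)
open Literature.Analysis.FunctionSpaces (PointConfig IsPoissonPointProcess)
open Literature.Probability.Percolation (SiteConfig blackRegion voronoiCrossing)
open Literature.Probability.RandomPlanarGeometry (ConformalRectangle ConformalEquiv cardyFunction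
  crossRatio)

/-! ### Eventual smallness of the thresholds -/

/-- `δ ^ a ≤ C` for all small `δ > 0` (`a > 0`, `C > 0`). [folklore] -/
theorem eventually_rpow_le_nhdsGT {a : ℝ} (ha : 0 < a) {C : ℝ} (hC : 0 < C) :
    ∀ᶠ δ in 𝓝[>] (0 : ℝ), δ ^ a ≤ C := by
  have h : Tendsto (fun δ : ℝ => δ ^ a) (𝓝[>] 0) (𝓝 0) := by
    have h' : Tendsto (fun δ : ℝ => δ ^ a) (𝓝 0) (𝓝 ((0 : ℝ) ^ a)) :=
      (Real.continuousAt_rpow_const 0 a (Or.inr ha.le)).tendsto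
    rw [Real.zero_rpow ha.ne'] at h'
    exact h'.mono_left nhdsWithin_le_nhds
  exact h.eventually_le_const hC

/-- **The thresholds along the schedule, eventually.**  For `r > 0` and all small `δ > 0`, with
`ρ = cellRad δ = δ^{3/32}`, `r₂ = sepRad δ = δ^{3/8}`, `ℓ₀ = edgeLen δ = δ^{5/8}`, `μ = 4δ`:
`4μ ≤ r₂` (`16 δ^{5/8} ≤ 1`), `64 μ ρ ≤ ℓ₀ r₂ = δ` (`256 δ^{3/32} ≤ 1`), `8ρ ≤ 1`, `4ρ ≤ r`,
`2δ ≤ r`, `δ < r`. [folklore] -/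
theorem eventually_thresholds {r : ℝ} (hr : 0 < r) :
    ∀ᶠ δ in 𝓝[>] (0 : ℝ), 0 < δ ∧ 4 * (4 * δ) ≤ sepRad δ ∧
      64 * (4 * δ) * cellRad δ ≤ edgeLen δ * sepRad δ ∧ 8 * cellRad δ ≤ 1 ∧
      4 * cellRad δ ≤ r ∧ 2 * δ ≤ r ∧ δ < r := by
  filter_upwards [self_mem_nhdsWithin,
    eventually_rpow_le_nhdsGT (a := 5 / 8) (by norm_num) (C := 1 / 16) (by norm_num),
    eventually_rpow_le_nhdsGT (a := 3 / 32) (by norm_num) (C := min (1 / 256) (r / 4))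
      (by positivity),
    eventually_rpow_le_nhdsGT (a := 1) one_pos (C := r / 2) (by positivity)] with δ hδ h58 h332 h1
  have hδ : 0 < δ := hδ
  rw [Real.rpow_one] at h1
  have h332a : δ ^ (3 / 32 : ℝ) ≤ 1 / 256 := h332.trans (min_le_left _ _)
  have h332b : δ ^ (3 / 32 : ℝ) ≤ r / 4 := h332.trans (min_le_right _ _)
  have e1 : δ ^ (3 / 8 : ℝ) * δ ^ (5 / 8 : ℝ) = δ := by
    rw [← Real.rpow_add hδ]; norm_num
  have e2 : δ ^ (5 / 8 : ℝ) * δ ^ (3 / 8 : ℝ) = δ := by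
    rw [← Real.rpow_add hδ]; norm_num
  have h38 : 0 ≤ δ ^ (3 / 8 : ℝ) := Real.rpow_nonneg hδ.le _
  refine ⟨hδ, ?_, ?_, ?_, ?_, ?_, ?_⟩
  · show 4 * (4 * δ) ≤ δ ^ (3 / 8 : ℝ)
    have := mul_le_mul_of_nonneg_left h58 h38
    rw [e1] at this
    linarith
  · show 64 * (4 * δ) * δ ^ (3 / 32 : ℝ) ≤ δ ^ (5 / 8 : ℝ) * δ ^ (3 / 8 : ℝ)
    rw [e2]
    have := mul_le_mul_of_nonneg_left h332a hδ.le
    linarith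
  · show 8 * δ ^ (3 / 32 : ℝ) ≤ 1
    linarith
  · show 4 * δ ^ (3 / 32 : ℝ) ≤ r
    linarith
  · linarith
  · linarith

/-! ### The sandwich -/

/-- **S3 + S4 — the dual sandwich at cell scale `δ^{1/8}` from S1, S2 and the fat tube**
(registered stub `stub_sandwich_of` of line `Sketch`).  The conclusion is VERBATIM the
hypothesis `hS` of `faithful_of_dual_sandwich_eighth` (Part 3b).  Lower inclusion: a black
crossing of `R₁` has a strictly black fat tube, which gives the crude block crossing of `R`
(Sandwich Part 1 `blockConfig_mem_crudeCrossing_of_tube`) unless there is a defect; upper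
inclusion: a crude block crossing of `R` and a white crossing of `R₂` force a defect (white fat
tube and Sandwich Part 1 `false_of_block_of_whiteTube`); then outer-measure bookkeeping with the
measurable event `Block` (`measurableSet_blockCrossing`), `Measure.prod_swap` for the white
probability, `eventually_lt_infDist_arc_two` (Part 7), `eventually_thresholds`, and the no-defect
bound on the window `cthickening 1 (closure Ω ∪ closure R₁ ∪ closure R₂)`.
[cite: BollobasRiordan2006, Ch. 7 Lemma 14 with (19)] -/
theorem stub_sandwich_of :
    (∀ (R : ConformalRectangle) (θ : ℝ), 0 < θ →
      ∃ (R₁ R₂ : ConformalRectangle) (φ₁ : ConformalEquiv upperHalfPlaneSet R₁.carrier)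
        (x₁ : Fin 4 → ℝ) (φ₂ : ConformalEquiv upperHalfPlaneSet R₂.carrier) (x₂ : Fin 4 → ℝ)
        (F₀ F₂ : Set ℂ) (r : ℝ), R₁.IsUniformizing φ₁ x₁ ∧ R₂.IsUniformizing φ₂ x₂ ∧
        (∀ (φ : ConformalEquiv upperHalfPlaneSet R.carrier) (x : Fin 4 → ℝ), R.IsUniformizing φ x →
          |cardyFunction (crossRatio x₁) - cardyFunction (crossRatio x)| ≤ θ ∧
          |(1 - cardyFunction (crossRatio x₂)) - cardyFunction (crossRatio x)| ≤ θ) ∧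
        r ∈ lowerMargins R R₁ F₀ F₂ ∧ r ∈ upperMargins R R₂) →
    (∀ (PB PW : Measure (PointConfig ℂ)),
      IsPoissonPointProcess (volume : Measure ℂ) PB → IsPoissonPointProcess (volume : Measure ℂ) PW →
      ∀ V : Set ℂ, Bornology.IsBounded V → (interior V).Nonempty →
      Tendsto (fun δ : ℝ => (PB.prod PW).real {c |
          (((δ ^ (1 / 8 : ℝ) : ℝ) : ℂ) • (c.1 : Set ℂ), ((δ ^ (1 / 8 : ℝ) : ℝ) : ℂ) • (c.2 : Set ℂ)) ∉
            noDefect V (cellRad δ) (sepRad δ) (edgeLen δ)})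
        (𝓝[>] 0) (𝓝 0)) →
    (∀ {B W V : Set ℂ} {ρ r₂ ℓ₀ μ : ℝ}, 0 < ρ → 0 < r₂ → 0 < ℓ₀ → 0 < μ →
      4 * μ ≤ r₂ → 64 * μ * ρ ≤ ℓ₀ * r₂ → (B, W) ∈ noDefect V ρ r₂ ℓ₀ →
      ∀ {x y : ℂ} (γ : Path x y), cthickening (8 * ρ) (range γ) ⊆ V →
      (∀ t, γ t ∈ blackRegion B W) → μ ∈ tubeMargins B W ρ γ) →
    ∀ (PB PW : Measure (PointConfig ℂ)),
      IsPoissonPointProcess (volume : Measure ℂ) PB → IsPoissonPointProcess (volume : Measure ℂ) PW →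
      ∀ (R : ConformalRectangle) (θ : ℝ), 0 < θ → ∃ (R₁ R₂ : ConformalRectangle)
        (φ₁ : ConformalEquiv upperHalfPlaneSet R₁.carrier) (x₁ : Fin 4 → ℝ)
        (φ₂ : ConformalEquiv upperHalfPlaneSet R₂.carrier) (x₂ : Fin 4 → ℝ),
        R₁.IsUniformizing φ₁ x₁ ∧ R₂.IsUniformizing φ₂ x₂ ∧
        (∀ (φ : ConformalEquiv upperHalfPlaneSet R.carrier) (x : Fin 4 → ℝ), R.IsUniformizing φ x →
          |cardyFunction (crossRatio x₁) - cardyFunction (crossRatio x)| ≤ θ ∧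
          |(1 - cardyFunction (crossRatio x₂)) - cardyFunction (crossRatio x)| ≤ θ) ∧
        ∀ᶠ δ in 𝓝[>] (0 : ℝ),
          voronoiCrossingProb PB PW R₁ (δ ^ (1 / 8 : ℝ)) - θ ≤ blockCrossingProb PB PW R δ (δ ^ (1 / 8 : ℝ)) ∧
          blockCrossingProb PB PW R δ (δ ^ (1 / 8 : ℝ)) ≤
            1 - voronoiCrossingProb PW PB R₂ (δ ^ (1 / 8 : ℝ)) + θ := by
  intro hS1 hS2 hT PB PW hPB hPW R θ hθ
  obtain ⟨R₁, R₂, φ₁, x₁, φ₂, x₂, F₀, F₂, r, hx₁, hx₂, hCardy, hlow, hup⟩ := hS1 R θ hθ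
  refine ⟨R₁, R₂, φ₁, x₁, φ₂, x₂, hx₁, hx₂, hCardy, ?_⟩
  haveI := hPB.isProbabilityMeasure
  haveI := hPW.isProbabilityMeasure
  obtain ⟨hr0, hF₀c, hF₂c, hdisj, hA, hB, hC, hD, hE, hF⟩ := hlow
  obtain ⟨-, hcross⟩ := hup
  -- the window
  set V : Set ℂ := cthickening 1 (closure R.carrier ∪ closure R₁.carrier ∪ closure R₂.carrier)
    with hV
  have hVb : Bornology.IsBounded V :=
    ((R.isBounded.closure.union R₁.isBounded.closure).union R₂.isBounded.closure).cthickening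
  have hRV : R.carrier ⊆ V := subset_closure.trans
    ((subset_union_left.trans subset_union_left).trans (self_subset_cthickening _))
  have hVi : (interior V).Nonempty := by
    obtain ⟨z, hz⟩ := R.nonempty
    exact ⟨z, (R.isOpen.subset_interior_iff.2 hRV) hz⟩
  have hR₁V : ∀ {ρ : ℝ}, 8 * ρ ≤ 1 → cthickening (8 * ρ) (closure R₁.carrier) ⊆ V := fun h =>
    (cthickening_mono h _).trans (cthickening_subset_of_subset _
      ((subset_union_right.trans subset_union_left :
        closure R₁.carrier ⊆ closure R.carrier ∪ closure R₁.carrier ∪ closure R₂.carrier)))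
  have hR₂V : ∀ {ρ : ℝ}, 8 * ρ ≤ 1 → cthickening (8 * ρ) (closure R₂.carrier) ⊆ V := fun h =>
    (cthickening_mono h _).trans (cthickening_subset_of_subset _ subset_union_right)
  -- eventually: thresholds, separation of `(ab)` and `(cd)`, and the no-defect bound
  filter_upwards [eventually_thresholds hr0, eventually_lt_infDist_arc_two R,
    (hS2 PB PW hPB hPW V hVb hVi).eventually_le_const hθ] with δ hth h02 hNθ
  obtain ⟨hδ, h4μ, h64, h8ρ, h4ρ, h2δ, hδr⟩ := hth
  set ε : ℝ := δ ^ (1 / 8 : ℝ) with hε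
  have hε0 : ε ≠ 0 := (Real.rpow_pos_of_pos hδ _).ne'
  have hρ : 0 < cellRad δ := Real.rpow_pos_of_pos hδ _
  have hr₂ : 0 < sepRad δ := Real.rpow_pos_of_pos hδ _
  have hℓ₀ : 0 < edgeLen δ := Real.rpow_pos_of_pos hδ _
  have hμ0 : (0 : ℝ) < 4 * δ := by positivity
  have hμ : δ / 2 < 4 * δ := by linarith
  set P : Measure (PointConfig ℂ × PointConfig ℂ) := PB.prod PW with hP
  set N : Set (PointConfig ℂ × PointConfig ℂ) := {c |
    ((ε : ℂ) • (c.1 : Set ℂ), (ε : ℂ) • (c.2 : Set ℂ)) ∉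
      noDefect V (cellRad δ) (sepRad δ) (edgeLen δ)} with hN
  set Blk : Set (PointConfig ℂ × PointConfig ℂ) := {c | blockConfig δ ε c ∈ crudeCrossing R δ}
    with hBlk
  have hBm : MeasurableSet Blk := measurableSet_blockCrossing R hδ hε0
  constructor
  · -- LOWER: `{vor R₁} ⊆ Block ∪ N`
    have hincl : {c : PointConfig ℂ × PointConfig ℂ |
        voronoiCrossing R₁.carrier (R₁.arc 0) (R₁.arc 2) ε (c.1 : Set ℂ) (c.2 : Set ℂ)} ⊆
        Blk ∪ N := by
      intro c hc
      by_cases hcN : c ∈ N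
      · exact Or.inr hcN
      left
      have hnd : ((ε : ℂ) • (c.1 : Set ℂ), (ε : ℂ) • (c.2 : Set ℂ)) ∈
          noDefect V (cellRad δ) (sepRad δ) (edgeLen δ) := not_not.1 hcN
      obtain ⟨x, y, γ, hx, hy, hγ⟩ := exists_path_of_voronoiCrossing_conformalRectangle R₁ hε0 c hc
      obtain ⟨x', y', γ', hx', hy', hnear, hball⟩ := hT hρ hr₂ hℓ₀ hμ0 h4μ h64 hnd γ
        ((cthickening_subset_of_subset _ (range_subset_iff.2 fun t => (hγ t).1)).trans (hR₁V h8ρ))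
        (fun t => (hγ t).2)
      exact blockConfig_mem_crudeCrossing_of_tube R R₁ hδ ε c hF₀c hF₂c hdisj hA hB hC hD hE hF
        hδr h4ρ hμ h02 hx hy (fun t => (hγ t).1) γ' hx' hy' hnear hball
    have hv : voronoiCrossingProb PB PW R₁ ε ≤ P.real (Blk ∪ N) := measureReal_mono hincl
    have hu := measureReal_union_le (μ := P) Blk N
    show voronoiCrossingProb PB PW R₁ ε - θ ≤ P.real Blk
    linarith
  · -- UPPER: `{vor^{white} R₂} ∩ Block ⊆ N`
    set E₂ : Set (PointConfig ℂ × PointConfig ℂ) := {c |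
      voronoiCrossing R₂.carrier (R₂.arc 0) (R₂.arc 2) ε (c.2 : Set ℂ) (c.1 : Set ℂ)} with hE₂
    have hswap : voronoiCrossingProb PW PB R₂ ε = P.real E₂ := by
      unfold voronoiCrossingProb
      rw [← Measure.prod_swap]
      show ((PB.prod PW).map
        (MeasurableEquiv.prodComm : PointConfig ℂ × PointConfig ℂ ≃ᵐ _)).real _ = _
      rw [measureReal_def, MeasurableEquiv.map_apply]
      rfl
    have hexcl : E₂ ∩ Blk ⊆ N := by
      rintro c ⟨hc, hblk⟩
      by_contra hcN
      have hnd : ((ε : ℂ) • (c.1 : Set ℂ), (ε : ℂ) • (c.2 : Set ℂ)) ∈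
          noDefect V (cellRad δ) (sepRad δ) (edgeLen δ) := not_not.1 hcN
      obtain ⟨p, q, P₀, hp, hq, hP₀⟩ := exists_path_of_voronoiCrossing hε0 hc
      obtain ⟨p', q', P', hp', hq', hnear, hball⟩ := hT hρ hr₂ hℓ₀ hμ0 h4μ h64
        (mem_noDefect_swap hnd) P₀
        ((cthickening_subset_of_subset _ (range_subset_iff.2 fun t => (hP₀ t).1)).trans (hR₂V h8ρ))
        (fun t => (hP₀ t).2)
      exact false_of_block_of_whiteTube R R₂ hδ ε c hcross h2δ h4ρ hμ hblk hp hq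
        (fun t => (hP₀ t).1) P' hp' hq' hnear hball
    have h1 : P.real (E₂ ∩ Blk) + P.real (E₂ \ Blk) = P.real E₂ := measureReal_inter_add_sdiff hBm
    have h2 : P.real (E₂ ∩ Blk) ≤ P.real N := measureReal_mono hexcl
    have h3 : P.real (E₂ \ Blk) ≤ P.real Blkᶜ := measureReal_mono fun c hc => hc.2
    have h4 : P.real Blkᶜ = 1 - P.real Blk := probReal_compl_eq_one_sub hBm
    show P.real Blk ≤ 1 - voronoiCrossingProb PW PB R₂ ε + θ
    rw [hswap]
    linarith

end Summit.CriticalPhenomena.CardyFormulaZ2.Cruxes.SquareFromVoronoiHub.VoronoiBlocks.Faithful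

end
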